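import Summits.BirchSwinnertonDyer.Rank1Residual.WAll.Conjunction
import Summits.BirchSwinnertonDyer.Rank1Residual.X2.ClassClosureEntireFree
import Literature.NumberTheory.EllipticCurves.Wuthrich2014.ThreeAdicImageSupersingularProofs
import HarnessLib

/-!
# Rung W-ALL of ladder BSD (D-0120) — the kernel with every DISCHARGED binder fed in: TWELVE named
# print facts instead of fourteen (cell `bsd-wall`, lane (2), seat `bsd-wall-ty-1`)

HONEST FRAMING (cell `bsd-wall`, run/shared/lean/pub/bsd-wall/; brief `WALL-BRIEF-v1.md` sha16
b966bf16da27706e): bookkeeping only — the theorems of `Rank1Residual/WAll/Conjunction.lean` with two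
of the fourteen print binders of `CornersAll` supplied BY THEOREMS OF THE TREE, exactly as
`Partition/CornersDischarged.lean` does for the partition forms:

* `hmod : hasEntireLFunction_rat` is a THEOREM given `hmodP : nonempty_modularParametrizationData`
  (`X2.ClassClosureEntireFree.hasEntireLFunction_rat_of_nonempty_modularParametrizationData`:
  BCDT 2001 Thm A in parametrisation form ⇒ a newform ⇒ `L(E,s)` entire, Diamond–Shurman 5.10.2);
* `hW20 : Wuthrich2014.lemma20_surjective_threeAdic_of_semistable` is DISCHARGED
  (`Wuthrich2014.lemma20_surjective_threeAdic_of_semistable_holds`,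
  `Literature/…/Wuthrich2014/ThreeAdicImageSupersingularProofs.lean`).

So the trust base of the kernel form of rung W-ALL is the closed list of exclusion classes plus
TWELVE named published facts — `hSk` Skinner 2016 Thm C · `hBCS` BCS25 Cor 1.3.1 (PUB\*) · `hJSW`
JSW17 Thm 1.2.1 (ss sub-case PUB\*) · `hCGS` CGS25 Thm D · `hGV` Greenberg–Vatsal 2000 Thm 1.3 ·
`hGr` Greenberg 1999 Thm 4.1 · `hmodP` modularity with `c ∈ ℤ` · `hGZK` Gross–Zagier–Kolyvagin ·
`hCM` Rubin 1991 / Burungale–Flach 2024 · `hKob` Kobayashi 2013 Cor 1.4 (PUB[sec]) · `hYZ` Yan–Zhu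
2026 Thm 4.15 (PUB\*) · `hLLT` Li–Liu–Tian 2024 Thm 1.1 — and, for the leading-term reading, the
two sign binders `hL0` (`L(E,1) ≥ 0`) and `hGZ` (Gross–Zagier in rank one). Nothing asserted,
nothing booked, no named fact introduced; PUB\* flags travel with the facts as everywhere in the
partition files.

References: `Rank1Residual/WAll/Target.lean`, `Rank1Residual/WAll/Conjunction.lean`,
`Partition/CornersDischarged.lean` (the same two discharges for the partition forms);
[cite: BCDTJAMS2001, Theorem A]; [cite: Wuthrich2014, Lemma 20 (p. 399)]; [cite: Miller2011LMS, §1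
and Def. 1.1].
-/

noncomputable section

open scoped Classical

open WeierstrassCurve Literature.NumberTheory.EllipticCurves
  Literature.NumberTheory.EllipticCurves.Rank1Residual Literature.NumberTheory.EllipticCurves.ModularForms
open Summit.BirchSwinnertonDyer.Rank1Residual
open Summit.BirchSwinnertonDyer.BirchSwinnertonDyer.Rank1Residual (NonCMAtTwo)
open Summit.BirchSwinnertonDyer.Rank1Residual.X2.ClassClosureEntireFree
  (hasEntireLFunction_rat_of_nonempty_modularParametrizationData)

set_option autoImplicit false

namespace Summit.BirchSwinnertonDyer

/-- **W-ALL FROM THE CONJUNCTION, TWELVE named facts** (`wAll_of_conjunction` with `hmod` derived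
from `hmodP` and Wuthrich 2014 Lemma 20 discharged): the twelve exclusion-class `Prop`s of the
closed list (row 1 = the reused leaf `NonCMAtTwo`) and twelve named published facts give `BSD(E,p)`
for every `E/ℚ` of analytic rank `≤ 1` and every prime `p`. [folklore] -/
theorem wAll_of_conjunction_discharged (h5 : NonCMAtTwo) (hAdd : WAllExclAdditive)
    (hM1 : WAllExclMultRankOne) (hX1 : WAllCornerX1) (hX2 : WAllCornerX2) (hX6 : WAllCornerX6r0)
    (hX7 : WAllCornerX7) (hX8 : WAllCornerX8) (hX9 : WAllCornerX9) (hX10b : WAllCornerX10b)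
    (hX11a : WAllCornerX11a) (hF : WAllCornerF)
    (hSk : Skinner2016.thmC_padicValRat_bsd_rank_zero)
    (hBCS : BurungaleCastellaSkinner2025.cor131_padicValRat_bsd_rank_le_one)
    (hJSW : JetchevSkinnerWan2017.thm121_padicValRat_bsd_rank_one)
    (hCGS : CastellaGrossiSkinner2025.thmD_padicValRat_bsd_rank_le_one)
    (hGV : GreenbergVatsal2000.thm13_charIdeal_eq_of_gvPar) (hGr : greenberg_charValue_rankZero)
    (hmodP : nonempty_modularParametrizationData)
    (hGZK : rank_eq_analyticRank_of_analyticRank_le_one)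
    (hCM : bsdTriple_of_hasCM_of_L_one_ne_zero) (hKob : Kobayashi2013.cor14_bsdp_of_cm_rank_one)
    (hYZ : YanZhu2026.thm415_padicValRat_bsd_rank_le_one)
    (hLLT : LiLiuTian2024.thm11_bsdp_of_cm_rank_one) : WAll :=
  wAll_of_conjunction h5 hAdd hM1 hX1 hX2 hX6 hX7 hX8 hX9 hX10b hX11a hF hSk hBCS hJSW hCGS hGV hGr
    (hasEntireLFunction_rat_of_nonempty_modularParametrizationData hmodP) hmodP hGZK hCM hKob hYZ
    Wuthrich2014.lemma20_surjective_threeAdic_of_semistable_holds hLLT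

/-- **W-ALL from the packaged conjunction, TWELVE named facts.** [folklore] -/
theorem wAll_of_exclusions_discharged (h : WAllExclusions)
    (hSk : Skinner2016.thmC_padicValRat_bsd_rank_zero)
    (hBCS : BurungaleCastellaSkinner2025.cor131_padicValRat_bsd_rank_le_one)
    (hJSW : JetchevSkinnerWan2017.thm121_padicValRat_bsd_rank_one)
    (hCGS : CastellaGrossiSkinner2025.thmD_padicValRat_bsd_rank_le_one)
    (hGV : GreenbergVatsal2000.thm13_charIdeal_eq_of_gvPar) (hGr : greenberg_charValue_rankZero)
    (hmodP : nonempty_modularParametrizationData)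
    (hGZK : rank_eq_analyticRank_of_analyticRank_le_one)
    (hCM : bsdTriple_of_hasCM_of_L_one_ne_zero) (hKob : Kobayashi2013.cor14_bsdp_of_cm_rank_one)
    (hYZ : YanZhu2026.thm415_padicValRat_bsd_rank_le_one)
    (hLLT : LiLiuTian2024.thm11_bsdp_of_cm_rank_one) : WAll :=
  wAll_of_exclusions h hSk hBCS hJSW hCGS hGV hGr
    (hasEntireLFunction_rat_of_nonempty_modularParametrizationData hmodP) hmodP hGZK hCM hKob hYZ
    Wuthrich2014.lemma20_surjective_threeAdic_of_semistable_holds hLLT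

/-- **The closed list is exactly W-ALL modulo TWELVE named facts.** [folklore] -/
theorem wAll_iff_exclusions_discharged (hSk : Skinner2016.thmC_padicValRat_bsd_rank_zero)
    (hBCS : BurungaleCastellaSkinner2025.cor131_padicValRat_bsd_rank_le_one)
    (hJSW : JetchevSkinnerWan2017.thm121_padicValRat_bsd_rank_one)
    (hCGS : CastellaGrossiSkinner2025.thmD_padicValRat_bsd_rank_le_one)
    (hGV : GreenbergVatsal2000.thm13_charIdeal_eq_of_gvPar) (hGr : greenberg_charValue_rankZero)
    (hmodP : nonempty_modularParametrizationData)
    (hGZK : rank_eq_analyticRank_of_analyticRank_le_one)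
    (hCM : bsdTriple_of_hasCM_of_L_one_ne_zero) (hKob : Kobayashi2013.cor14_bsdp_of_cm_rank_one)
    (hYZ : YanZhu2026.thm415_padicValRat_bsd_rank_le_one)
    (hLLT : LiLiuTian2024.thm11_bsdp_of_cm_rank_one) : WAll ↔ WAllExclusions :=
  ⟨wAllExclusions_of_wAll, fun h ↦ wAll_of_exclusions_discharged h hSk hBCS hJSW hCGS hGV hGr hmodP
    hGZK hCM hKob hYZ hLLT⟩

/-- **`WAll` ⇒ the leading-term form**, with modularity in parametrisation form (`hmodP`) in place
of `hmod`; the sign binders `hL0` (`L(E,1) ≥ 0`) and `hGZ` (Gross–Zagier, rank one) remain.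
[cite: Miller2011LMS, §1 and Def. 1.1] -/
theorem wAllFormula_of_wAll_discharged (hmodP : nonempty_modularParametrizationData)
    (hL0 : re_entireLFunction_one_nonneg) (hGZ : gross_zagier_rank_one_rat) (h : WAll) : WAllFormula :=
  wAllFormula_of_wAll (hasEntireLFunction_rat_of_nonempty_modularParametrizationData hmodP) hL0 hGZ h

/-- **The leading-term form of rung W-ALL from the closed list**, TWELVE named facts and the two
sign binders. [folklore] -/
theorem wAllFormula_of_exclusions_discharged (h : WAllExclusions)
    (hSk : Skinner2016.thmC_padicValRat_bsd_rank_zero)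
    (hBCS : BurungaleCastellaSkinner2025.cor131_padicValRat_bsd_rank_le_one)
    (hJSW : JetchevSkinnerWan2017.thm121_padicValRat_bsd_rank_one)
    (hCGS : CastellaGrossiSkinner2025.thmD_padicValRat_bsd_rank_le_one)
    (hGV : GreenbergVatsal2000.thm13_charIdeal_eq_of_gvPar) (hGr : greenberg_charValue_rankZero)
    (hmodP : nonempty_modularParametrizationData)
    (hGZK : rank_eq_analyticRank_of_analyticRank_le_one)
    (hCM : bsdTriple_of_hasCM_of_L_one_ne_zero) (hKob : Kobayashi2013.cor14_bsdp_of_cm_rank_one)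
    (hYZ : YanZhu2026.thm415_padicValRat_bsd_rank_le_one)
    (hLLT : LiLiuTian2024.thm11_bsdp_of_cm_rank_one)
    (hL0 : re_entireLFunction_one_nonneg) (hGZ : gross_zagier_rank_one_rat) : WAllFormula :=
  wAllFormula_of_wAll_discharged hmodP hL0 hGZ
    (wAll_of_exclusions_discharged h hSk hBCS hJSW hCGS hGV hGr hmodP hGZK hCM hKob hYZ hLLT)

end Summit.BirchSwinnertonDyer

end
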